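import Summits.AtomisticToContinuum.Crystallization.Theses.LaminarSixThreeThree
import Summits.AtomisticToContinuum.Crystallization.Theorems.SquareWellLayerCakeStackingFaultSparsityQualitativeRigidity
import Summits.AtomisticToContinuum.Crystallization.Theorems.LaminarSixThreeThreeStackingFaultSparsityOfLaminarCruxes

/-! POSITIVE CONTROL (strategist r1, stmt-14295): the route `LaminarSixThreeThree` closes WITHOUT its crux
`LaminarRigidity` — `LjLaminarity → LaminarSaturation → CrysPeriodicMinAttained → Crystallization` from LANDED
theorems only (p150153 `LaminarBarlowWindows_of_laminarity_saturation` / `StackingFaultSparsity_of_laminarity_saturation`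
via the qualitative rigidity `stub_qualitativeRigidity`; proved supports 14299, 14300, 3243, 0626).  Expected: rc 0, no sorry.
This certifies that stmt-14295 is OFF THE CONE of `closes` in substance (it is consumed by the term of `closes` only through
`LaminarToBarlow`, whose conclusion `LaminarBarlowWindows` the tree now derives from 14293 ∧ 14294 alone). -/

namespace Summit.AtomisticToContinuum.Crystallization.Cruxes.LaminarRigidity.StrategistR1

open Summit.AtomisticToContinuum.Crystallization.Theses.LaminarSixThreeThree
open Summit.AtomisticToContinuum.Crystallization.Theorems

/-- The route's conclusion from items 14293, 14294, 0627 alone (14295 and 14296 discharged by landed theorems). -/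
theorem crystallization_without_14295 (hLam : LjLaminarity) (hSat : LaminarSaturation)
    (hMin : CrysPeriodicMinAttained) : _root_.Crystallization := by
  have hX : LaminarBarlowWindows :=
    SquareWellLayerCake.StackingFaultSparsity.QualitativeRigidity.LaminarBarlowWindows_of_laminarity_saturation hLam hSat
  have hS : StackingFaultSparsity :=
    SquareWellLayerCake.StackingFaultSparsity.QualitativeRigidity.StackingFaultSparsity_of_laminarity_saturation hLam hSat
  have hPW : PeriodicWindows := hcpWindowsToPeriodicWindows_proof (barlowToHcpWindows_proof hX hS)
  refine ⟨?_, HullCriterion_holds hPW⟩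
  obtain ⟨P, hP⟩ := hMin
  refine ⟨P, hP, ?_⟩
  have h : (⨅ Q : Literature.MathematicalPhysics.StatisticalMechanics.PeriodicConfiguration 3,
      Q.energyPerParticle Literature.MathematicalPhysics.StatisticalMechanics.lennardJones) =
      P.energyPerParticle Literature.MathematicalPhysics.StatisticalMechanics.lennardJones :=
    hP.csInf_eq
  have hLim := CrysEnergyLimit_holds
  unfold CrysEnergyLimit at hLim
  rw [h] at hLim
  exact hLim

/-- The `closes`-shaped corollary: every binder of `closes` except 14293/14294/0627 is dischargeable, in particular the
binder `LaminarRigidity` is not needed. -/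
theorem closes_without_14295 : LjLaminarity → LaminarSaturation → CrysPeriodicMinAttained → _root_.Crystallization :=
  crystallization_without_14295

end Summit.AtomisticToContinuum.Crystallization.Cruxes.LaminarRigidity.StrategistR1
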